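import Literature.Analysis.FunctionSpaces.LittlewoodPaleySmooth
import Literature.Analysis.FluidPDE.LerayHopfProofs
import Literature.Analysis.FluidPDE.WholeSpaceIBP
import Mathlib.Analysis.InnerProductSpace.Laplacian
import HarnessLib

/-!
# Calculus of smooth `L²` fields: Laplacian, divergence, gradient, integration by parts, blocks

Analysis/FluidPDE support file (serves the discharge of
`Literature.Analysis.FluidPDE.cheskidov_shvydkoy`, ns.S31). The dynamic half of the block energy
identity of Cheskidov–Shvydkoy's Lemma 3.2 (arXiv:0708.3067, (8): `½ d/dt ‖u_q‖²₂ + ν‖∇u_q‖²₂ =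
-∫ (u ⊗ u)_q · ∇u_q`, on an interval of regularity) substitutes the Navier–Stokes equations for
`∂ₜu`, integrates the viscous term by parts and kills the pressure against the divergence-free
block. This file provides the whole-space calculus for the slices, which are smooth `L²` fields
(`Literature.Analysis.FunctionSpaces.IsSmoothL2Field`, `LittlewoodPaleySmooth.lean`), all **proved**:

* closure of `IsSmoothL2Field` / `HasBoundedDerivs` under `Δ`, `(u·∇)`, `∇`, `div`, components;
* integration by parts without boundary terms (Mathlib's
  `integral_bilinear_hasFDerivAt_right_eq_neg_left_of_integrable`, all pairings in `L¹` since the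
  fields and their derivatives are in `L²`): `∫ ⟪w, Δw⟫ = -∑_i ∫ ‖∂_i w‖²`
  (`IsSmoothL2Field.integral_inner_laplacian`) and `∫ ⟪w, ∇q⟫ = -∫ (div w) q`
  (`IsSmoothL2Field.integral_inner_gradient`);
* the blocks commute with the operations: `∂_e Δ̇_j = Δ̇_j ∂_e`, `Δ Δ̇_j = Δ̇_j Δ`, `div Δ̇_j = Δ̇_j div`,
  `Δ̇_j ∇ = ∇ Δ̇_j` (`HasBoundedDerivs.laplacian_blockFn`, `divergence_blockFn`, `blockFn_gradient`), from
  `Dⁿ(Δ̇_j u) = Δ̇_j(Dⁿu)` (`LittlewoodPaleySmooth.lean`).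

## References

* A. Cheskidov, R. Shvydkoy, Arch. Ration. Mech. Anal. 195 (2010), proof of Lemma 3.2, (8)
  (arXiv:0708.3067, p. 5). [CheskidovShvydkoy2010]
* J. Leray, Acta Math. 63 (1934), §6 (1.11) (Green's identities on the whole space). [Leray1934]
-/

noncomputable section

open MeasureTheory Filter Topology Function Set
open Literature.Analysis.FunctionSpaces
open scoped ENNReal NNReal RealInnerProductSpace Laplacian

namespace Literature.Analysis.FluidPDE

variable {E : Type*} [NormedAddCommGroup E] [InnerProductSpace ℝ E] [FiniteDimensional ℝ E]
  [MeasurableSpace E] [BorelSpace E]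
variable {E' : Type*} [NormedAddCommGroup E'] [InnerProductSpace ℝ E']

/-! ## Closure of the smooth `L²` class under the vector-calculus operations -/

section Closure

/-- Finite sums of smooth `L²` fields. [folklore] -/
theorem _root_.Literature.Analysis.FunctionSpaces.IsSmoothL2Field.finset_sum {ι : Type*} (s : Finset ι) {v : ι → E → E'}
    (h : ∀ i ∈ s, IsSmoothL2Field (v i)) : IsSmoothL2Field (∑ i ∈ s, v i) := by
  classical
  induction s using Finset.induction_on with
  | empty =>
    simp only [Finset.sum_empty]
    refine ⟨HasBoundedDerivs.zero, fun n => ?_⟩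
    have h0 : ∀ x, ‖iteratedFDeriv ℝ n (0 : E → E') x‖ₑ ^ 2 = 0 := fun x => by
      rw [iteratedFDeriv_zero, Pi.zero_apply, ← ofReal_norm, norm_zero, ENNReal.ofReal_zero,
        zero_pow two_ne_zero]
    simp_rw [h0, lintegral_zero]
    exact ENNReal.zero_lt_top
  | insert a s ha ih =>
    rw [Finset.sum_insert ha]
    exact (h a (Finset.mem_insert_self a s)).add (ih fun i hi => h i (Finset.mem_insert_of_mem hi))

/-- The Laplacian of a smooth `L²` field is a smooth `L²` field. [folklore] -/
theorem _root_.Literature.Analysis.FunctionSpaces.IsSmoothL2Field.laplacian [CompleteSpace E'] {v : E → E'}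
    (h : IsSmoothL2Field v) : IsSmoothL2Field (Δ v) := by
  have hrep : (Δ v) = ∑ i, fun x => fderiv ℝ (fun y => fderiv ℝ v y (stdOrthonormalBasis ℝ E i)) x
      (stdOrthonormalBasis ℝ E i) := by
    funext x
    rw [laplacian_eq_sum_fderiv_fderiv (stdOrthonormalBasis ℝ E) (h.contDiff_nat 2) x, Finset.sum_apply]
  rw [hrep]
  exact IsSmoothL2Field.finset_sum _ fun i _ => (h.fderiv_apply _).fderiv_apply _

/-- Constant vectors times smooth `L²` scalars are smooth `L²` fields. [folklore] -/
theorem _root_.Literature.Analysis.FunctionSpaces.IsSmoothL2Field.smul_const {φ : E → ℝ} (h : IsSmoothL2Field φ) (e : E') :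
    IsSmoothL2Field (fun x => φ x • e) :=
  h.clm_comp (ContinuousLinearMap.smulRight (1 : ℝ →L[ℝ] ℝ) e)

/-- The components of a smooth `L²` field are smooth `L²` scalars. [folklore] -/
theorem _root_.Literature.Analysis.FunctionSpaces.IsSmoothL2Field.inner_const {v : E → E'} (h : IsSmoothL2Field v) (e : E') :
    IsSmoothL2Field (fun x => ⟪v x, e⟫) := by
  have : (fun x => ⟪v x, e⟫) = fun x => (innerSL ℝ e) (v x) := by
    funext x; rw [innerSL_apply_apply, real_inner_comm]
  rw [this]
  exact h.clm_comp _

omit [FiniteDimensional ℝ E] [MeasurableSpace E] [BorelSpace E] in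
/-- The components of a smooth bounded field are smooth bounded scalars. [folklore] -/
theorem _root_.Literature.Analysis.FunctionSpaces.HasBoundedDerivs.inner_const {v : E → E'} (h : HasBoundedDerivs v) (e : E') :
    HasBoundedDerivs (fun x => ⟪v x, e⟫) := by
  have : (fun x => ⟪v x, e⟫) = fun x => (innerSL ℝ e) (v x) := by
    funext x; rw [innerSL_apply_apply, real_inner_comm]
  rw [this]
  exact h.clm_comp _

/-- **The convective term of smooth `L²` fields is a smooth `L²` field**: `(u·∇)v = ∑_i u_i ∂_i v`
with `u_i` smooth bounded and `∂_i v` smooth `L²`. [folklore] -/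
theorem _root_.Literature.Analysis.FunctionSpaces.IsSmoothL2Field.convect [CompleteSpace E'] {u : E → E} {v : E → E'}
    (hu : HasBoundedDerivs u) (hv : IsSmoothL2Field v) :
    IsSmoothL2Field (FluidPDE.convect u v) := by
  set b := stdOrthonormalBasis ℝ E
  have hrep : FluidPDE.convect u v = ∑ i, fun x => ⟪u x, b i⟫ • fderiv ℝ v x (b i) := by
    funext x
    rw [convect_apply, Finset.sum_apply]
    conv_lhs => rw [← b.sum_repr' (u x)]
    simp only [map_sum, map_smul, real_inner_comm (u x)]
  rw [hrep]
  exact IsSmoothL2Field.finset_sum _ fun i _ => (hv.fderiv_apply (b i)).smul_left (hu.inner_const (b i))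

/-- **The gradient of a smooth `L²` scalar is a smooth `L²` field**: `∇φ = ∑_i (∂_i φ) b_i`. [folklore] -/
theorem _root_.Literature.Analysis.FunctionSpaces.IsSmoothL2Field.gradient {φ : E → ℝ} (h : IsSmoothL2Field φ) :
    IsSmoothL2Field (_root_.gradient φ) := by
  haveI : CompleteSpace E := FiniteDimensional.complete ℝ E
  set b := stdOrthonormalBasis ℝ E
  have hrep : _root_.gradient φ = ∑ i, fun x => fderiv ℝ φ x (b i) • b i := by
    funext x
    rw [Finset.sum_apply]
    conv_lhs => rw [← b.sum_repr' (_root_.gradient φ x)]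
    refine Finset.sum_congr rfl fun i _ => ?_
    rw [inner_gradient_right_eq_fderiv]
  rw [hrep]
  exact IsSmoothL2Field.finset_sum _ fun i _ => (h.fderiv_apply (b i)).smul_const (b i)

omit [MeasurableSpace E] [BorelSpace E] in
/-- The divergence of a smooth bounded field is a smooth bounded scalar. [folklore] -/
theorem _root_.Literature.Analysis.FunctionSpaces.HasBoundedDerivs.divergence {u : E → E} (h : HasBoundedDerivs u) :
    HasBoundedDerivs (VectorCalculus.divergence u) := by
  set b := stdOrthonormalBasis ℝ E
  have hrep : VectorCalculus.divergence u = fun x => ∑ i, ⟪fderiv ℝ u x (b i), b i⟫ := by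
    funext x
    rw [divergence_eq_sum_inner_fderiv b]
    exact Finset.sum_congr rfl fun i _ => real_inner_comm _ _
  rw [hrep]
  have : (fun x => ∑ i, ⟪fderiv ℝ u x (b i), b i⟫) = ∑ i, fun x => ⟪fderiv ℝ u x (b i), b i⟫ := by
    funext x; simp
  rw [this]
  classical
  induction (Finset.univ : Finset (Fin (Module.finrank ℝ E))) using Finset.induction_on with
  | empty => simpa using HasBoundedDerivs.zero
  | insert a s ha ih =>
    rw [Finset.sum_insert ha]
    exact ((h.fderiv_apply (b a)).inner_const (b a)).add ih

end Closure

/-! ## Integration by parts for smooth `L²` fields on the whole space -/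

section IBP

/-- **`∫ ⟪w, ∂_e ∂_e w⟫ = -∫ ‖∂_e w‖²`** for a smooth `L²` field (Mathlib's whole-space integration
by parts `integral_bilinear_hasFDerivAt_right_eq_neg_left_of_integrable`; all pairings are in
`L¹` because `w, ∂_e w, ∂_e ∂_e w ∈ L²`). [folklore] -/
theorem _root_.Literature.Analysis.FunctionSpaces.IsSmoothL2Field.integral_inner_fderiv_fderiv {w : E → E'}
    (hw : IsSmoothL2Field w) (e : E) :
    ∫ x, ⟪w x, fderiv ℝ (fun y => fderiv ℝ w y e) x e⟫ = -∫ x, ‖fderiv ℝ w x e‖ ^ 2 := by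
  set g : E → E' := fun y => fderiv ℝ w y e with hg
  have hgS : IsSmoothL2Field g := hw.fderiv_apply e
  have h2 : MemLp w 2 volume := hw.memLp_two
  have hg2 : MemLp g 2 volume := hgS.memLp_two
  have hgg2 : MemLp (fun x => fderiv ℝ g x e) 2 volume := hgS.memLp_fderiv_apply e
  have i1 : Integrable (fun x => ⟪fderiv ℝ w x e, g x⟫) volume :=
    integrable_inner_of_memLp_two (hw.memLp_fderiv_apply e) hg2
  have i2 : Integrable (fun x => ⟪w x, fderiv ℝ g x e⟫) volume := integrable_inner_of_memLp_two h2 hgg2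
  have i3 : Integrable (fun x => ⟪w x, g x⟫) volume := integrable_inner_of_memLp_two h2 hg2
  have key := integral_bilinear_hasFDerivAt_right_eq_neg_left_of_integrable (μ := (volume : Measure E))
    (B := innerSL ℝ (E := E')) (f := w) (f' := fderiv ℝ w) (g := g) (g' := fderiv ℝ g) (v := e)
    i1 i2 i3 (fun x _ => ((hw.contDiff_nat 1).differentiable one_ne_zero x).hasFDerivAt)
    (fun x _ => ((hgS.contDiff_nat 1).differentiable one_ne_zero x).hasFDerivAt)
  have key' : ∫ x, ⟪w x, fderiv ℝ g x e⟫ = -∫ x, ⟪fderiv ℝ w x e, g x⟫ := key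
  rw [key']
  congr 1
  refine integral_congr_ae (Eventually.of_forall fun x => ?_)
  simp only [hg, real_inner_self_eq_norm_sq]

/-- **`∫ ⟪w, Δw⟫ = -∑_i ∫ ‖∂_i w‖²`** for a smooth `L²` field (Green's first identity on the whole
space, no boundary terms; Leray 1934, (1.11)). [folklore] -/
theorem _root_.Literature.Analysis.FunctionSpaces.IsSmoothL2Field.integral_inner_laplacian {w : E → E'}
    (hw : IsSmoothL2Field w) :
    ∫ x, ⟪w x, (Δ w) x⟫ = -∑ i, ∫ x, ‖fderiv ℝ w x (stdOrthonormalBasis ℝ E i)‖ ^ 2 := by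
  set b := stdOrthonormalBasis ℝ E
  have hrep : ∀ x, ⟪w x, (Δ w) x⟫ = ∑ i, ⟪w x, fderiv ℝ (fun y => fderiv ℝ w y (b i)) x (b i)⟫ := by
    intro x
    rw [laplacian_eq_sum_fderiv_fderiv (stdOrthonormalBasis ℝ E) (hw.contDiff_nat 2) x, inner_sum]
  simp_rw [hrep]
  rw [integral_finsetSum _ fun i _ => ?_]
  · rw [← Finset.sum_neg_distrib]
    exact Finset.sum_congr rfl fun i _ => hw.integral_inner_fderiv_fderiv (b i)
  · exact integrable_inner_of_memLp_two hw.memLp_two ((hw.fderiv_apply (b i)).memLp_fderiv_apply (b i))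

omit [BorelSpace E] [MeasurableSpace E] [FiniteDimensional ℝ E] in
/-- The components `⟪w, e⟫` have derivative `⟪Dw · , e⟫`. [folklore] -/
theorem hasFDerivAt_inner_const_field {w : E → E} (hw : ContDiff ℝ 1 w) (e x : E) :
    HasFDerivAt (fun y => ⟪w y, e⟫) ((innerSL ℝ e).comp (fderiv ℝ w x)) x := by
  have h1 : HasFDerivAt w (fderiv ℝ w x) x := (hw.differentiable one_ne_zero x).hasFDerivAt
  have h2 := (innerSL ℝ e).hasFDerivAt.comp x h1
  have heq : (fun y => ⟪w y, e⟫) = (innerSL ℝ e) ∘ w := by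
    funext y; simp only [Function.comp_apply, innerSL_apply_apply, real_inner_comm]
  rw [heq]; exact h2

/-- **`∫ ⟪w, ∇q⟫ = -∫ (div w) q`** for a smooth `L²` vector field `w` and a smooth `L²` scalar `q`
(whole-space integration by parts componentwise, `⟪w, ∇q⟫ = ∑_i w_i ∂_i q`,
`div w = ∑_i ∂_i w_i`). [folklore] -/
theorem _root_.Literature.Analysis.FunctionSpaces.IsSmoothL2Field.integral_inner_gradient {w : E → E}
    (hw : IsSmoothL2Field w) {q : E → ℝ} (hq : IsSmoothL2Field q) :
    ∫ x, ⟪w x, gradient q x⟫ = -∫ x, VectorCalculus.divergence w x * q x := by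
  haveI : CompleteSpace E := FiniteDimensional.complete ℝ E
  set b := stdOrthonormalBasis ℝ E
  -- componentwise expansion of `⟪w, ∇q⟫`
  have hrep : ∀ x, ⟪w x, gradient q x⟫ = ∑ i, ⟪w x, b i⟫ * fderiv ℝ q x (b i) := by
    intro x
    rw [inner_gradient_right_eq_fderiv]
    conv_lhs => rw [← b.sum_repr' (w x)]
    simp only [map_sum, map_smul, smul_eq_mul, real_inner_comm (w x)]
  -- each component integrates by parts
  have hcomp : ∀ i, ∫ x, ⟪w x, b i⟫ * fderiv ℝ q x (b i) =
      -∫ x, ⟪fderiv ℝ w x (b i), b i⟫ * q x := by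
    intro i
    have hφS : IsSmoothL2Field (fun x => ⟪w x, b i⟫) := hw.inner_const (b i)
    have hdS : IsSmoothL2Field (fun x => ⟪fderiv ℝ w x (b i), b i⟫) :=
      (hw.fderiv_apply (b i)).inner_const (b i)
    have i1 : Integrable (fun x => ⟪fderiv ℝ w x (b i), b i⟫ * q x) volume := by
      have := hdS.memLp_two.integrable_mul hq.memLp_two
      simpa only [Pi.mul_def] using this
    have i2 : Integrable (fun x => ⟪w x, b i⟫ * fderiv ℝ q x (b i)) volume := by
      have := hφS.memLp_two.integrable_mul (hq.memLp_fderiv_apply (b i))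
      simpa only [Pi.mul_def] using this
    have i3 : Integrable (fun x => ⟪w x, b i⟫ * q x) volume := by
      have := hφS.memLp_two.integrable_mul hq.memLp_two
      simpa only [Pi.mul_def] using this
    have key := integral_bilinear_hasFDerivAt_right_eq_neg_left_of_integrable (μ := (volume : Measure E))
      (B := ContinuousLinearMap.mul ℝ ℝ) (f := fun x => ⟪w x, b i⟫)
      (f' := fun x => (innerSL ℝ (b i)).comp (fderiv ℝ w x))
      (g := q) (g' := fderiv ℝ q) (v := b i) ?_ i2 i3 (fun x _ => hasFDerivAt_inner_const_field (hw.contDiff_nat 1) (b i) x)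
      (fun x _ => ((hq.contDiff_nat 1).differentiable one_ne_zero x).hasFDerivAt)
    · have key' : ∫ x, ⟪w x, b i⟫ * fderiv ℝ q x (b i) = -∫ x, ⟪b i, fderiv ℝ w x (b i)⟫ * q x := key
      rw [key']
      congr 1
      exact integral_congr_ae (Eventually.of_forall fun x => by simp only [real_inner_comm (b i)])
    · have : (fun x => (ContinuousLinearMap.mul ℝ ℝ) (((innerSL ℝ (b i)).comp (fderiv ℝ w x)) (b i)) (q x)) =
          fun x => ⟪fderiv ℝ w x (b i), b i⟫ * q x := by
        funext x
        simp only [ContinuousLinearMap.mul_apply', ContinuousLinearMap.coe_comp, Function.comp_apply,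
          innerSL_apply_apply, real_inner_comm]
      rw [this]; exact i1
  simp_rw [hrep]
  rw [integral_finsetSum _ fun i _ => ?_]
  · simp_rw [hcomp]
    rw [Finset.sum_neg_distrib, ← integral_finsetSum _ fun i _ => ?_]
    · congr 1
      refine integral_congr_ae (Eventually.of_forall fun x => ?_)
      simp only
      rw [divergence_eq_sum_inner_fderiv b, Finset.sum_mul]
      exact Finset.sum_congr rfl fun i _ => by rw [real_inner_comm]
    · have := ((hw.fderiv_apply (b i)).inner_const (b i)).memLp_two.integrable_mul hq.memLp_two
      simpa only [Pi.mul_def] using this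
  · have := (hw.inner_const (b i)).memLp_two.integrable_mul (hq.memLp_fderiv_apply (b i))
    simpa only [Pi.mul_def] using this

end IBP

/-! ## The blocks commute with the vector-calculus operations -/

section Commute

variable [CompleteSpace E']

/-- `∂_e (Δ̇_j u) = Δ̇_j (∂_e u)` for smooth bounded fields. [folklore] -/
theorem _root_.Literature.Analysis.FunctionSpaces.HasBoundedDerivs.fderiv_blockFn_apply {u : E → E'}
    (hu : HasBoundedDerivs u) (j : ℤ) (e : E) :
    (fun x => fderiv ℝ (blockFn j u) x e) = blockFn j (fun x => fderiv ℝ u x e) := by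
  rw [hu.fderiv_blockFn j]
  obtain ⟨M, hM⟩ := hu.exists_norm_fderiv_le
  exact (blockFn_comp_clm_of_bound j (ContinuousLinearMap.apply ℝ E' e)
    (hu.contDiff.continuous_fderiv (by simp)).aestronglyMeasurable hM).symm

/-- **`Δ (Δ̇_j u) = Δ̇_j (Δ u)`** for smooth bounded fields (`D²(Δ̇_j u) = Δ̇_j (D² u)` and the
Laplacian is a fixed linear function of `D²`). [folklore] -/
theorem _root_.Literature.Analysis.FunctionSpaces.HasBoundedDerivs.laplacian_blockFn {u : E → E'}
    (hu : HasBoundedDerivs u) (j : ℤ) : Δ (blockFn j u) = blockFn j (Δ u) := by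
  set b := stdOrthonormalBasis ℝ E
  -- the Laplacian as a continuous linear function of the second derivative
  set L : (E [×2]→L[ℝ] E') →L[ℝ] E' :=
    ∑ i, ContinuousMultilinearMap.apply ℝ (fun _ : Fin 2 => E) E' ![b i, b i] with hL
  have hLap : ∀ f : E → E', Δ f = fun x => L (iteratedFDeriv ℝ 2 f x) := by
    intro f
    rw [InnerProductSpace.laplacian_eq_iteratedFDeriv_orthonormalBasis f b]
    funext x
    simp [hL]
  rw [hLap, hLap, hu.iteratedFDeriv_blockFn j 2]
  obtain ⟨M, hM⟩ := hu.bounded 2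
  have hc : Continuous fun x => iteratedFDeriv ℝ 2 u x :=
    hu.contDiff.continuous_iteratedFDeriv (WithTop.coe_le_coe.2 le_top)
  exact (blockFn_comp_clm_of_bound j L hc.aestronglyMeasurable hM).symm

/-- **`div (Δ̇_j u) = Δ̇_j (div u)`** for smooth bounded vector fields (`D(Δ̇_j u) = Δ̇_j (Du)` and the
divergence is the trace of `D`). [folklore] -/
theorem _root_.Literature.Analysis.FunctionSpaces.HasBoundedDerivs.divergence_blockFn {u : E → E}
    (hu : HasBoundedDerivs u) (j : ℤ) :
    VectorCalculus.divergence (blockFn j u) = blockFn j (VectorCalculus.divergence u) := by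
  set b := stdOrthonormalBasis ℝ E
  set L : (E →L[ℝ] E) →L[ℝ] ℝ := ∑ i, (innerSL ℝ (b i)).comp (ContinuousLinearMap.apply ℝ E (b i)) with hL
  have hdiv : ∀ f : E → E, VectorCalculus.divergence f = fun x => L (fderiv ℝ f x) := by
    intro f; funext x
    rw [divergence_eq_sum_inner_fderiv b]
    simp [hL, innerSL_apply_apply]
  rw [hdiv, hdiv, hu.fderiv_blockFn j]
  obtain ⟨M, hM⟩ := hu.exists_norm_fderiv_le
  exact (blockFn_comp_clm_of_bound j L (hu.contDiff.continuous_fderiv (by simp)).aestronglyMeasurable hM).symm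

/-- **`Δ̇_j (∇P) = ∇(Δ̇_j P)`** for smooth bounded scalars (`∇P = ∑_i (∂_i P) b_i` and
`∂_i (Δ̇_j P) = Δ̇_j (∂_i P)`). [folklore] -/
theorem _root_.Literature.Analysis.FunctionSpaces.HasBoundedDerivs.blockFn_gradient {P : E → ℝ}
    (hP : HasBoundedDerivs P) (j : ℤ) : blockFn j (gradient P) = gradient (blockFn j P) := by
  haveI : CompleteSpace E := FiniteDimensional.complete ℝ E
  haveI : Fact (1 ≤ (∞ : ℝ≥0∞)) := ⟨le_top⟩
  set b := stdOrthonormalBasis ℝ E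
  have hrep : ∀ {Q : E → ℝ}, gradient Q = ∑ i, fun x => fderiv ℝ Q x (b i) • b i := by
    intro Q; funext x
    rw [Finset.sum_apply]
    conv_lhs => rw [← b.sum_repr' (gradient Q x)]
    exact Finset.sum_congr rfl fun i _ => by rw [inner_gradient_right_eq_fderiv]
  have hmem : ∀ i, MemLp (fun x => fderiv ℝ P x (b i) • b i) ∞ volume := fun i =>
    memLp_top_of_hasBoundedDerivs ((hP.fderiv_apply (b i)).clm_comp
      (ContinuousLinearMap.smulRight (1 : ℝ →L[ℝ] ℝ) (b i)))
  rw [hrep, hrep, blockFn_sum j _ fun i _ => hmem i]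
  refine Finset.sum_congr rfl fun i _ => ?_
  have h1 := blockFn_comp_clm j (ContinuousLinearMap.smulRight (1 : ℝ →L[ℝ] ℝ) (b i))
    (memLp_top_of_hasBoundedDerivs (hP.fderiv_apply (b i)))
  simp only [ContinuousLinearMap.smulRight_apply, one_apply_eq_self] at h1
  rw [h1, ← hP.fderiv_blockFn_apply j (b i)]

end Commute

end Literature.Analysis.FluidPDE

end
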